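import Summits.AtomisticToContinuum.Crystallization.Theorems.FrustratedLawDichotomyAveragingCutB

/-!
# FrustratedLawDichotomy · AVERAGING CUT, part C (§4 regimes and pieces, §5 the literal instances 9/2 and 5, §6 FDG and the crux BY NAME, §7 the dial)

Continuation of `FrustratedLawDichotomyAveragingCut` (lens-5 g35 sha256 90945e53d8094482, 650 l; PRE-SPLIT by hand-2 g12 for the 400-line rule —
bodies byte-identical, same namespace; see the module docstring of part A for the node).  `--supports stmt-AtomisticToContinuum-27623 --as helper`.
-/

noncomputable section

namespace Summit.AtomisticToContinuum.Crystallization.Theorems.FrustratedLawDichotomyAveragingCut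


open scoped BigOperators Classical
open Literature.MathematicalPhysics.StatisticalMechanics (interactionEnergy lennardJones siteEnergy two_mul_interactionEnergy
  neg_one_div_le_lennardJones card_le_of_separated_of_dist_le)
open Summit.AtomisticToContinuum.Crystallization.Theorems.FrustratedLawDichotomyRangeCut
open Summit.AtomisticToContinuum.Crystallization.Theorems.FrustratedLawDichotomySchurCut


/-! ## §4. The three regimes of a ball and the PIECES of the node (any admissible instance `(W, e)`) -/

/-- Regime predicate: some TIGHTLY good site (`GoodAt (1/20)`) lies in `B(i,ρ)`. -/
def TightNear (ρ : ℝ) {N : ℕ} (y : Fin N → E3) (i : Fin N) : Prop := ∃ j ∈ ball ρ y i, GoodAt (1 / 20) y j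

/-- Regime predicate: some LOOSELY BAD site (`¬GoodAt (1/8)`) lies in `B(i,ρ)`. -/
def BadNear (ρ : ℝ) {N : ℕ} (y : Fin N → E3) (i : Fin N) : Prop := ∃ j ∈ ball ρ y i, ¬GoodAt (1 / 8) y j

/-- **The explicit tight allowance** `C_T⁰(R,B,e,ρ) := D(R,B,e)·(1 + Mball ρ²)` that makes every tight-near ball solvent. -/
def CT₀ (R B e ρ : ℝ) : ℝ := Dfl R B e * (1 + Mball ρ ^ 2)

/-- `Dfl_le_CT₀` (formal bookkeeping). [folklore] -/
theorem Dfl_le_CT₀ {R B e : ℝ} (hR : 0 ≤ R) (hB : 0 ≤ B) (ρ : ℝ) : Dfl R B e ≤ CT₀ R B e ρ := by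
  unfold CT₀; nlinarith [Dfl_pos (e := e) hR hB, sq_nonneg (Mball ρ)]

/-- **PIECE (T) — TIGHT ABSORPTION** `TightAbsorption W e ρ C_T`: every ball `B(i,ρ)` containing a tightly good site has ball average
`S_i(C_T) ≥ 0`.  Tag: COSTUME(trivial for `C_T ≥ C_T⁰(ρ)`, PROVED below — `tightAbsorption_holds`): the free allowance `C_T` of the target
pays for ANY bounded deficit within `ρ` of a tight site.  This is the piece that ELIMINATES `C_T` from the residual. -/
def TightAbsorption (W : ℝ → ℝ) (e ρ CT : ℝ) : Prop :=
  ∀ (N : ℕ) (y : Fin N → E3), Function.Injective y → Sep y → ∀ i : Fin N, TightNear ρ y i → 0 ≤ ballAvg ρ y (xS W e CT y) i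

/-- **PIECE (F1) — STRAINED-PATCH PRICING** `StrainedPatchPricing W e ρ` (C_T-FREE): a ball `B(i,ρ)` all of whose sites are LOOSELY GOOD
but NOT tightly good (every site `1/20 ≤ η_j < 1/8`: an elastically strained close-packed patch, no defect, no perfect site) has
`S_i(0) = Σ_{j∈B(i,ρ)} (½Σ_k W(r_jk) − e)/#B(j,ρ) ≥ 0`.  Tag: WEAKER (a consequence of `T′♭`-with-`LAP` restricted to one regime; must-fail
probe `StrainedPatchPricing … → T′♭` in `bc/AveragingCut_probes.lean`); leaf ATTACKABLE-L (local elastic stability of the Barlow stackings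
under `W` at strain amplitude `≥ 1/20`: a finite-dimensional Taylor/Hessian estimate on the `(ρ+R)`-cluster; evidence: homogeneous shear of hcp
at `η = 1/20` gives sitewise surplus `+2.4e-3` (both instances), isolated displacements `≥ +2.0e-2`, `scripts/avgcut.py`). -/
def StrainedPatchPricing (W : ℝ → ℝ) (e ρ : ℝ) : Prop :=
  ∀ (N : ℕ) (y : Fin N → E3), Function.Injective y → Sep y → ∀ i : Fin N,
    ¬TightNear ρ y i → ¬BadNear ρ y i → 0 ≤ ballAvg ρ y (xS W e 0 y) i

/-- **PIECE (F2) — TIGHT-FREE DEFECT PRICING** `TightFreeDefectPricing W e ρ` (C_T-FREE): a ball `B(i,ρ)` with NO tightly good site but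
at least one loosely BAD site (`η_j ≥ 1/8` or non-12 topology: the defect core seen WITHOUT any perfect crystal within `ρ`) has `S_i(0) ≥ 0`,
i.e. the bad sites' binding deficit PLUS their `κ_T = 1/100` surcharge is financed by the surplus of the sites within `ρ` — icosahedral /
Frank–Kasper / bcc-like cores bind WORSE than `e` by `≥ 2·10⁻²` per site (MEASURED for both instances: Mackay axis `+1.0e-2` after surcharge,
Z12 of A15 `+1.5e-2`, bcc `+2.0e-2`, Mackay centre `+4.8e-2`).  Tag: UNDECIDED — stated test: an adversarial basin-hopping search (census
instrument) over `7/10`-separated clusters of `≤ 60` atoms EMBEDDED in a relaxed close-packed matrix for a TIGHT-FREE ball `B(i, 1.15)` with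
`S_i(0) < 0` decides it at `ρ = 1.15 = 1.18·d` (one shell; none found among fcc/hcp/sheared-hcp/Bain-path/bcc/A15/vacancy/
tangential-displacement/random-field/compressed-core/Mackay-309,923 probes: ≈ 380 tight-free balls, min `S_i(0) = +6.5e-3`); leaf IDEA-NEEDED (the
`C_T`-free, perfect-crystal-free core of `T′♭`: a LOCAL frustration inequality «no 7/10-separated arrangement within `ρ+R` of a non-close-packed
site beats the uniform close-packed energy density `e` by more than its own surplus pool»). -/
def TightFreeDefectPricing (W : ℝ → ℝ) (e ρ : ℝ) : Prop :=
  ∀ (N : ℕ) (y : Fin N → E3), Function.Injective y → Sep y → ∀ i : Fin N,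
    ¬TightNear ρ y i → BadNear ρ y i → 0 ≤ ballAvg ρ y (xS W e 0 y) i

/-- In a tight-free ball the allowance `C_T` is invisible: `S_i(C_T) = S_i(0)`. [folklore] -/
theorem ballAvg_xS_eq_of_not_tightNear {W : ℝ → ℝ} {e ρ CT : ℝ} {N : ℕ} {y : Fin N → E3} {i : Fin N} (h : ¬TightNear ρ y i) :
    ballAvg ρ y (xS W e CT y) i = ballAvg ρ y (xS W e 0 y) i := by
  unfold ballAvg
  refine Finset.sum_congr rfl fun j hj => ?_
  have hng : ¬GoodAt (1 / 20) y j := fun hg => h ⟨j, hj, hg⟩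
  simp only [xS, surplus, if_neg hng, mul_zero]

/-- **PIECE (T) PROVED**: `TightAbsorption W e ρ C_T` for every admissible instance, every `ρ ≥ 0` and `C_T ≥ C_T⁰(R,B,e,ρ)`
(packing + the crude floors of §3). -/
theorem tightAbsorption_holds {W : ℝ → ℝ} {R B e ρ CT : ℝ} (hW : CutBounds W R B) (hρ : 0 ≤ ρ) (hCT : CT₀ R B e ρ ≤ CT) :
    TightAbsorption W e ρ CT := by
  intro N y hy hs i hT
  obtain ⟨a, ha, hga⟩ := hT
  have hD : 0 ≤ Dfl R B e := (Dfl_pos hW.range_nonneg hW.floor_nonneg).le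
  have hDC := Dfl_le_CT₀ (e := e) hW.range_nonneg hW.floor_nonneg ρ
  have hCT0 : 0 ≤ CT := le_trans hD (hDC.trans hCT)
  have hM1 := one_le_Mball hρ
  have key := sum_div_ge_of_one_large (ball ρ y i) ha (xS W e CT y) (fun j => ((ball ρ y j).card : ℝ))
    (L := CT - Dfl R B e) (M := Mball ρ) (D := Dfl R B e) (by linarith) hD
    (fun j _ => by exact_mod_cast one_le_card_ball hρ y j) (card_ball_le hρ hs a) (card_ball_le hρ hs i)
    (fun j _ => xS_ge hW hCT0 hs j) (xS_ge_of_good hW hs hga)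
  have hMpos : 0 < Mball ρ := by linarith
  have hbound : Mball ρ * Dfl R B e ≤ (CT - Dfl R B e) / Mball ρ := by
    rw [le_div_iff₀ hMpos]
    unfold CT₀ at hCT
    nlinarith
  unfold ballAvg
  linarith

/-- **THE SPLIT (PROVED, by cases on the regime of each ball)**: `(T) ∧ (F1) ∧ (F2) ⟹ LAP_ρ`. -/
theorem ballAveragedPricing_of_pieces {W : ℝ → ℝ} {e ρ CT : ℝ} (hT : TightAbsorption W e ρ CT) (h1 : StrainedPatchPricing W e ρ)
    (h2 : TightFreeDefectPricing W e ρ) : BallAveragedPricing ρ (1 / 20) (1 / 8) W e (1 / 100) CT := by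
  intro N y hy hs i
  by_cases ht : TightNear ρ y i
  · exact hT N y hy hs i ht
  · rw [show surplus (1 / 20) (1 / 8) W e (1 / 100) CT y = xS W e CT y from rfl, ballAvg_xS_eq_of_not_tightNear ht]
    by_cases hb : BadNear ρ y i
    · exact h2 N y hy hs i ht hb
    · exact h1 N y hy hs i ht hb

/-- **GENERIC NODE THEOREM**: for every admissible Schur cut `(w, ω, A)` with `CutBounds (effPot w ω A) R B` and every radius `ρ ≥ 0`,
`StrainedPatchPricing → TightFreeDefectPricing → SchurTopologicalPricing (1/20) (1/8) w ω A eUp (1/100) (C_T⁰(R,B,eUp+A,ρ))`. PROVED. -/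
theorem schurTopologicalPricing_of_tightFree {w ω : ℝ → ℝ} {A eUp R B ρ : ℝ} (hW : CutBounds (effPot w ω A) R B) (hρ : 0 ≤ ρ)
    (h1 : StrainedPatchPricing (effPot w ω A) (eUp + A) ρ) (h2 : TightFreeDefectPricing (effPot w ω A) (eUp + A) ρ) :
    SchurTopologicalPricing (1 / 20) (1 / 8) w ω A eUp (1 / 100) (CT₀ R B (eUp + A) ρ) :=
  schurTopologicalPricing_of_ballAveraged hρ (ballAveragedPricing_of_pieces (tightAbsorption_holds hW hρ le_rfl) h1 h2)

/-- Variant keeping `C_T` free (any `C_T ≥ C_T⁰`). -/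
theorem schurTopologicalPricing_of_tightFree' {w ω : ℝ → ℝ} {A eUp R B ρ CT : ℝ} (hW : CutBounds (effPot w ω A) R B) (hρ : 0 ≤ ρ)
    (hCT : CT₀ R B (eUp + A) ρ ≤ CT)
    (h1 : StrainedPatchPricing (effPot w ω A) (eUp + A) ρ) (h2 : TightFreeDefectPricing (effPot w ω A) (eUp + A) ρ) :
    SchurTopologicalPricing (1 / 20) (1 / 8) w ω A eUp (1 / 100) CT :=
  schurTopologicalPricing_of_ballAveraged hρ (ballAveragedPricing_of_pieces (tightAbsorption_holds hW hρ hCT) h1 h2)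

/-! ## §5. The two literal instances of column 27623: RANGE 9/2 (residual OF RECORD, critic row 505) and RANGE 5 (audited twin) -/

/-- `W₄₅ := effPot w₄₅ ω₄ (3/400)` — the potential OF RECORD (`= V_LJ` on `[0,3]`, `C¹`-released on `[3,9/2]`, `0` beyond `9/2`, minus
`2A·ω₂(5r/4)`, `A = 3/400`; tree `…SchurCutB`, floor `SF₄₅` certified in exact rationals, TAG 181-S(i) amendment A). -/
abbrev W₄₅ : ℝ → ℝ := effPot w₄₅ ω₄ (3 / 400)

/-- `e₄₅ := eUp + A = −7175/10000 + 3/400 = −0.71` — the per-site level of record. -/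
abbrev e₄₅ : ℝ := -(7175 / 10000) + 3 / 400

/-- `W₅ := effPot w₅ ω₅ (13/4000)` — the range-5 twin (`A = 13/4000`, floor `SF₅`). -/
abbrev W₅ : ℝ → ℝ := effPot w₅ ω₅ (13 / 4000)

/-- `e₅ := −7175/10000 + 13/4000 = −0.71425`. -/
abbrev e₅ : ℝ := -(7175 / 10000) + 13 / 4000

/-- `w₄₅_mem` (formal bookkeeping). [folklore] -/
theorem w₄₅_mem (r : ℝ) : 0 ≤ w₄₅ r ∧ w₄₅ r ≤ 1 := by
  unfold w₄₅ cutWeight; exact smoothstep₁_mem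

/-- `w₅_mem` (formal bookkeeping). [folklore] -/
theorem w₅_mem (r : ℝ) : 0 ≤ w₅ r ∧ w₅ r ≤ 1 := by
  unfold w₅ cutWeight; exact smoothstep₂_mem

/-- **`W₄₅` is admissible with range `9/2` and floor `1`** (`1/12 + 104·3/400 = 0.8633 ≤ 1`; `effPot_fourHalf_eq_zero`). [folklore] -/
theorem W₄₅_cutBounds : CutBounds W₄₅ (9 / 2) 1 where
  range_nonneg := by norm_num
  floor_nonneg := by norm_num
  floor r hr := by
    have h := effPot_ge (w := w₄₅) (ω := ω₄) (r := r) (by norm_num : (0 : ℝ) ≤ 3 / 400) (w₄₅_mem r)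
      (by unfold ω₄; exact omega₂_le (by positivity))
    exact le_trans (by norm_num) h
  vanish r hr := effPot_fourHalf_eq_zero _ hr.le

/-- **`W₅` is admissible with range `5` and floor `1/2`** (`1/12 + 104·13/4000 = 0.4213 ≤ 1/2`; `effPot_five_eq_zero`). [folklore] -/
theorem W₅_cutBounds : CutBounds W₅ 5 (1 / 2) where
  range_nonneg := by norm_num
  floor_nonneg := by norm_num
  floor r hr := by
    have h := effPot_ge (w := w₅) (ω := ω₅) (r := r) (by norm_num : (0 : ℝ) ≤ 13 / 4000) (w₅_mem r)
      (by unfold ω₅; exact omega₂_le hr)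
    exact le_trans (by norm_num) h
  vanish r hr := effPot_five_eq_zero _ hr.le

/-- The explicit tight allowances of the two instances. -/
abbrev CT₄₅ (ρ : ℝ) : ℝ := CT₀ (9 / 2) 1 e₄₅ ρ
/-- `CT₅` (formal bookkeeping). [folklore] -/
abbrev CT₅ (ρ : ℝ) : ℝ := CT₀ 5 (1 / 2) e₅ ρ

/-- **NODE THEOREM OF RECORD (range 9/2)**: for every radius `ρ ≥ 0`,
`StrainedPatchPricing W₄₅ e₄₅ ρ → TightFreeDefectPricing W₄₅ e₄₅ ρ → T′♭₄₅(C_T⁴⁵(ρ))` — the residual of record of column 27623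
(`SchurTopologicalPricing (1/20) (1/8) w₄₅ ω₄ (3/400) (−0.7175) (1/100) C_T`, critic row 505) with its free constant INSTANTIATED, from the two
`C_T`-free, perfect-crystal-free local pieces.  PROVED. -/
theorem schurTopologicalPricing_fourHalf_of_tightFree {ρ : ℝ} (hρ : 0 ≤ ρ) (h1 : StrainedPatchPricing W₄₅ e₄₅ ρ)
    (h2 : TightFreeDefectPricing W₄₅ e₄₅ ρ) :
    SchurTopologicalPricing (1 / 20) (1 / 8) w₄₅ ω₄ (3 / 400) (-(7175 / 10000)) (1 / 100) (CT₄₅ ρ) :=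
  schurTopologicalPricing_of_tightFree (eUp := -(7175 / 10000)) W₄₅_cutBounds hρ h1 h2

/-- Record instance, `C_T` free (any `C_T ≥ C_T⁴⁵(ρ)`). -/
theorem schurTopologicalPricing_fourHalf_of_tightFree' {ρ CT : ℝ} (hρ : 0 ≤ ρ) (hCT : CT₄₅ ρ ≤ CT)
    (h1 : StrainedPatchPricing W₄₅ e₄₅ ρ) (h2 : TightFreeDefectPricing W₄₅ e₄₅ ρ) :
    SchurTopologicalPricing (1 / 20) (1 / 8) w₄₅ ω₄ (3 / 400) (-(7175 / 10000)) (1 / 100) CT :=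
  schurTopologicalPricing_of_tightFree' (eUp := -(7175 / 10000)) W₄₅_cutBounds hρ hCT h1 h2

/-- **NODE THEOREM, range-5 twin**: `StrainedPatchPricing W₅ e₅ ρ → TightFreeDefectPricing W₅ e₅ ρ → T′♭₅(C_T⁵(ρ))`. PROVED. -/
theorem schurTopologicalPricing_five_of_tightFree {ρ : ℝ} (hρ : 0 ≤ ρ) (h1 : StrainedPatchPricing W₅ e₅ ρ)
    (h2 : TightFreeDefectPricing W₅ e₅ ρ) :
    SchurTopologicalPricing (1 / 20) (1 / 8) w₅ ω₅ (13 / 4000) (-(7175 / 10000)) (1 / 100) (CT₅ ρ) :=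
  schurTopologicalPricing_of_tightFree (eUp := -(7175 / 10000)) W₅_cutBounds hρ h1 h2

/-- Twin instance, `C_T` free. -/
theorem schurTopologicalPricing_five_of_tightFree' {ρ CT : ℝ} (hρ : 0 ≤ ρ) (hCT : CT₅ ρ ≤ CT)
    (h1 : StrainedPatchPricing W₅ e₅ ρ) (h2 : TightFreeDefectPricing W₅ e₅ ρ) :
    SchurTopologicalPricing (1 / 20) (1 / 8) w₅ ω₅ (13 / 4000) (-(7175 / 10000)) (1 / 100) CT :=
  schurTopologicalPricing_of_tightFree' (eUp := -(7175 / 10000)) W₅_cutBounds hρ hCT h1 h2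

/-! ## §6. End to end: `FDG` and the crux `AperiodicFrustratedLawGap` BY NAME, both instances -/

/-- **`FDG` from the Schur cut OF RECORD (range 9/2) with `T′♭₄₅` replaced by the two local pieces** (any `ρ ≥ 0`). -/
theorem fdg_fourHalf_of_tightFree {ρ CE DE : ℝ} (hρ : 0 ≤ ρ) (hF : SF₄₅) (hU : PeriodicEnergyCeiling (-(7175 / 10000)))
    (h1 : StrainedPatchPricing W₄₅ e₄₅ ρ) (h2 : TightFreeDefectPricing W₄₅ e₄₅ ρ)
    (hE : SchurElasticPricing (1 / 20) (1 / 8) w₄₅ ω₄ (3 / 400) (-(7175 / 10000)) (1 / 1000) CE DE) : FDG :=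
  fdg_of_split_schurCut_fourHalf hF hU (schurTopologicalPricing_fourHalf_of_tightFree hρ h1 h2) hE

/-- **The crux `AperiodicFrustratedLawGap` (stmt-AtomisticToContinuum-27623) BY NAME, record instance**: door, Schur floor `SF₄₅`
(KNOWN·CERTIFIED, exact rationals), periodic ceiling, elastic piece `E′♭₄₅`, and the two local pieces of this node. -/
theorem aperiodicFrustratedLawGap_fourHalf_of_tightFree {ρ CE DE : ℝ} (hρ : 0 ≤ ρ)
    (hDoor : Summit.AtomisticToContinuum.Crystallization.Theses.GrainCoreNetworkSplit.MuEquilibriumDoor)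
    (hF : SF₄₅) (hU : PeriodicEnergyCeiling (-(7175 / 10000)))
    (h1 : StrainedPatchPricing W₄₅ e₄₅ ρ) (h2 : TightFreeDefectPricing W₄₅ e₄₅ ρ)
    (hE : SchurElasticPricing (1 / 20) (1 / 8) w₄₅ ω₄ (3 / 400) (-(7175 / 10000)) (1 / 1000) CE DE) :
    Summit.AtomisticToContinuum.Crystallization.Theses.FrustratedLawDichotomy.AperiodicFrustratedLawGap :=
  aperiodicFrustratedLawGap_of_fdg hDoor (fdg_fourHalf_of_tightFree hρ hF hU h1 h2 hE)

/-- `FDG`, range-5 twin. -/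
theorem fdg_five_of_tightFree {ρ CE DE : ℝ} (hρ : 0 ≤ ρ) (hF : SF₅) (hU : PeriodicEnergyCeiling (-(7175 / 10000)))
    (h1 : StrainedPatchPricing W₅ e₅ ρ) (h2 : TightFreeDefectPricing W₅ e₅ ρ)
    (hE : SchurElasticPricing (1 / 20) (1 / 8) w₅ ω₅ (13 / 4000) (-(7175 / 10000)) (1 / 1000) CE DE) : FDG :=
  fdg_of_split_schurCut_five hF hU (schurTopologicalPricing_five_of_tightFree hρ h1 h2) hE

/-- The crux BY NAME, range-5 twin. -/
theorem aperiodicFrustratedLawGap_five_of_tightFree {ρ CE DE : ℝ} (hρ : 0 ≤ ρ)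
    (hDoor : Summit.AtomisticToContinuum.Crystallization.Theses.GrainCoreNetworkSplit.MuEquilibriumDoor)
    (hF : SF₅) (hU : PeriodicEnergyCeiling (-(7175 / 10000)))
    (h1 : StrainedPatchPricing W₅ e₅ ρ) (h2 : TightFreeDefectPricing W₅ e₅ ρ)
    (hE : SchurElasticPricing (1 / 20) (1 / 8) w₅ ω₅ (13 / 4000) (-(7175 / 10000)) (1 / 1000) CE DE) :
    Summit.AtomisticToContinuum.Crystallization.Theses.FrustratedLawDichotomy.AperiodicFrustratedLawGap :=
  aperiodicFrustratedLawGap_of_split_schurCut_five hDoor hF hU (schurTopologicalPricing_five_of_tightFree hρ h1 h2) hE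

/-! ## §7. The dial: radius `0` is SITEWISE pricing (audit twin, MEASURED FALSE), radius `∞` is the target -/

/-- **SITEWISE pricing** (the radius-`0` twin): every site's own surplus is `≥ 0`.  MEASURED FALSE for both instances (witnesses: a
16-coordinated compressed core — 16 neighbours at distance `1`, shells `31 @ 1.62`, `60 @ 2.45`, all pairs `≥ 7/10` — has centre surplus
`x(any C_T) = −0.13` (the repulsion among its neighbours is invisible to its own half-sum); fcc with iid Gaussian displacements of std `0.02·d`
has strained sites at `−1.2e-2`; one atom displaced tangentially by `0.10·d` leaves a strained neighbour at `−1.6e-3`; `scripts/overopt.py`,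
`avgcut.py fccrand 0.02 3` / `fccdisp 0.10`), which is why the node averages over a ball: one shell (`ρ = 1.15 = 1.18·d`) restores `S_i ≥ 0` on
every tested family (≈ 380 tight-free balls, min `+6.5e-3`; tight-near balls min `+2.3e-3` even at `C_T = 0`; the compressed core's one-shell
average is `+3.58`). -/
def SitewisePricing (W : ℝ → ℝ) (e CT : ℝ) : Prop :=
  ∀ (N : ℕ) (y : Fin N → E3), Function.Injective y → Sep y → ∀ i : Fin N, 0 ≤ xS W e CT y i

/-- Under the hard core a ball of radius `< 7/10` is the centre alone. [folklore] -/
theorem ball_eq_singleton {ρ : ℝ} (hρ0 : 0 ≤ ρ) (hρ : ρ < 7 / 10) {N : ℕ} {y : Fin N → E3} (hs : Sep y) (i : Fin N) :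
    ball ρ y i = {i} := by
  ext j
  rw [mem_ball, Finset.mem_singleton]
  constructor
  · intro hj
    by_contra hne
    have := hs j i hne
    linarith
  · rintro rfl
    rw [dist_self]; exact hρ0

/-- **Radius-0 twin**: for `0 ≤ ρ < 7/10`, `LAP_ρ` IS sitewise pricing. [folklore] -/
theorem ballAveragedPricing_iff_sitewise {W : ℝ → ℝ} {e ρ CT : ℝ} (hρ0 : 0 ≤ ρ) (hρ : ρ < 7 / 10) :
    BallAveragedPricing ρ (1 / 20) (1 / 8) W e (1 / 100) CT ↔ SitewisePricing W e CT := by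
  have key : ∀ {N : ℕ} (y : Fin N → E3), Sep y → ∀ i : Fin N, ballAvg ρ y (xS W e CT y) i = xS W e CT y i := by
    intro N y hs i
    unfold ballAvg
    rw [ball_eq_singleton hρ0 hρ hs i, Finset.sum_singleton, ball_eq_singleton hρ0 hρ hs i, Finset.card_singleton]
    simp
  constructor
  · intro h N y hy hs i
    have := h N y hy hs i
    rwa [key y hs i] at this
  · intro h N y hy hs i
    rw [show surplus (1 / 20) (1 / 8) W e (1 / 100) CT y = xS W e CT y from rfl, key y hs i]
    exact h N y hy hs i

/-- If `ρ` exceeds the diameter of the configuration every ball is everything. [folklore] -/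
theorem ball_eq_univ {ρ : ℝ} {N : ℕ} {y : Fin N → E3} (hdiam : ∀ a b : Fin N, dist (y a) (y b) ≤ ρ) (i : Fin N) :
    ball ρ y i = Finset.univ := by
  ext j; simp [mem_ball, hdiam j i]

/-- **Radius-∞ twin (COSTUME end of the dial)**: once `ρ` exceeds the diameter of the configuration, EVERY ball average equals the global mean
`(Σ_j x_j)/N`, so `LAP_ρ` evaluated on that configuration is exactly the global inequality `Σ_j x_j ≥ 0` (= `T′♭` there).  No single finite `ρ`
is this twin for all `N` — the node lives strictly between radius `0` (sitewise, FALSE) and radius `∞` (the target). [folklore] -/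
theorem ballAvg_eq_mean_of_diam_le {ρ : ℝ} {N : ℕ} {y : Fin N → E3} (hdiam : ∀ a b : Fin N, dist (y a) (y b) ≤ ρ) (x : Fin N → ℝ)
    (i : Fin N) : ballAvg ρ y x i = (∑ j, x j) / N := by
  unfold ballAvg
  simp only [ball_eq_univ hdiam, Finset.card_univ, Fintype.card_fin, Finset.sum_div]

-- (part C ends)
end Summit.AtomisticToContinuum.Crystallization.Theorems.FrustratedLawDichotomyAveragingCut
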